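import Literature.NumberTheory.LocalFields.UnramifiedQuadraticLatticeDoubleCosets     -- ★ γ1 p841089/p841112 (Mars in matrix dress, σ-form over the DVR `R`)
import Literature.NumberTheory.Automorphic.HermitianLatticesLocal                    -- ★ `LocalConjDatum` (B-p17's valued frame)
import HarnessLib

/-!
# The `R ↔ K` bridge for (F3c-γ): Mars' factorisation `g = ι(z)·diag(1,ϖ^j)·k` read in the valued field `K`
(Flicker (1998), *Elementary proof of the fundamental lemma for a unitary group*, REMARK p. 84, Prop. 6 p. 83)

Topic `NumberTheory/Automorphic`; namespace `Literature.NumberTheory.Automorphic.UnitaryGroup.TorusBridge`.  KERNEL mathematics only: theorems, no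
definition, no named fact, no instance, no notation, no `sorry`.  Cell `pub/hodgecm-mathlib`, programme P3a, road «D-N7-inert», MAP v3 «N7-ns COUNT FROM
FLICKER», brick (F3c-γ) «LATTICE ↔ COSET TRANSPORT» FILE γ2b-B §1 (LEAD F0P3a-plan (g9) T8-60 (C); architect A-p06 (g26); bridge binders «=» A-p03 (g24)
04:54:30Z ∕ B-p04 (g33) 04:42:58Z: abstract `(R, i, hiv, σR, hσi)`, instantiated at `R := 𝒪[K]`, `i := subtype` by the junction).  HC_CM is proved only modulo
the printed citations (2 remaining named inputs hLiu418, h413) until rung 0 closes; this file discharges no named fact.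

MATHEMATICS.  `K` a valued field, `R` an abstract DVR with `i : R →+* K` injective onto `{x : |x| ≤ 1}` and an involution `σR` compatible with `σ`
(`i ∘ σR = σ ∘ i`); `dR ∈ R` with `σR dR − dR` a unit (the traceless generator `d = σa − a` of the unramified quadratic ring), `ϖR` a `σR`-fixed
uniformiser.  §1 LIFTING: an integral `σ`-fixed element of `K` lifts to a `σR`-fixed element of `R`; units of `R` map to elements of valuation `1`.
§2 **MARS IN `K`**: a `σ`-fixed `g ∈ M₂(K)` with INTEGRAL entries and `det g ≠ 0` factors ENTRYWISE as `g = ι_d(z)·diag(1, ϖ^j)·k` with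
`z = u + v·d ≠ 0` (`u, v` integral `σ`-fixed), `k = (U₀ U₁; W₀ W₁)` integral `σ`-fixed with `|U₀W₁ − U₁W₀| = 1`, `ι_d(u + vd) = (u, −v·dσd; v, u + v(d+σd))`
— ★ γ1 `exists_coords_eq_iota_diag_pow` pushed through `i`.

References: [Flicker1998UnitaryFL] Y. Z. Flicker, Canad. J. Math. 50 (1998), REMARK p. 84; Prop. 6 p. 83 · [Serre1979] J.-P. Serre, *Local Fields*, Ch. V §2 Prop. 2. -/

set_option autoImplicit false

open scoped WithZero

namespace Literature.NumberTheory.Automorphic.UnitaryGroup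

namespace TorusBridge

open Literature.NumberTheory.LocalFields.UnramifiedQuadraticNorm

universe u

variable {K : Type*} [Field K] [Valued K ℤᵐ⁰] (σ : K →+* K)
  {R : Type u} [CommRing R] (i : R →+* K) (hi : Function.Injective i)
  (hiv : ∀ x : K, Valued.v x ≤ 1 ↔ x ∈ Set.range i) (σR : R →+* R) (hσi : ∀ r, i (σR r) = σ (i r))

/-! ## §1 Lifting along `i` -/

include hi hiv hσi in
/-- An integral `σ`-fixed element of `K` lifts to a `σR`-fixed element of `R`. [cite: Serre1979, Ch. V §2 Prop. 2] -/
theorem exists_lift_fixed {x : K} (hx : Valued.v x ≤ 1) (hσx : σ x = x) : ∃ r : R, σR r = r ∧ i r = x := by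
  obtain ⟨r, rfl⟩ := (hiv x).1 hx
  refine ⟨r, hi ?_, rfl⟩
  rw [hσi, hσx]

include hiv in
/-- Units of `R` have valuation `1` in `K`. [cite: Serre1979, Ch. V §2 Prop. 2] -/
theorem v_eq_one_of_isUnit {r : R} (hr : IsUnit r) : Valued.v (i r) = 1 := by
  obtain ⟨w, hw⟩ := hr.exists_right_inv
  have h1 : Valued.v (i r) ≤ 1 := (hiv _).2 ⟨r, rfl⟩
  have h2 : Valued.v (i w) ≤ 1 := (hiv _).2 ⟨w, rfl⟩
  have h3 : Valued.v (i r) * Valued.v (i w) = 1 := by rw [← map_mul, ← map_mul, hw, map_one, map_one]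
  refine le_antisymm h1 ?_
  calc (1 : ℤᵐ⁰) = Valued.v (i r) * Valued.v (i w) := h3.symm
    _ ≤ Valued.v (i r) * 1 := mul_le_mul_right h2 _
    _ = Valued.v (i r) := mul_one _

/-- Valuations of images lie in `{≤ 1}`. [cite: Serre1979, Ch. V §2 Prop. 2] -/
theorem v_le_one (hiv : ∀ x : K, Valued.v x ≤ 1 ↔ x ∈ Set.range i) (r : R) : Valued.v (i r) ≤ 1 := (hiv _).2 ⟨r, rfl⟩

/-! ## §2 Mars' factorisation read in `K` -/

include hi hiv hσi in
/-- **MARS' FACTORISATION IN `K`** (★ γ1 `exists_coords_eq_iota_diag_pow` through the bridge): for a `σ`-fixed `g ∈ M₂(K)` with integral entries and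
`g₀₀g₁₁ − g₀₁g₁₀ ≠ 0`, there are integral `σ`-fixed `u v U₀ U₁ W₀ W₁ ∈ K` and `j ≥ 0` with `z := u + v·d ≠ 0` (`d := i dR`), `|U₀W₁ − U₁W₀| = 1`
(`k ∈ GL₂(𝒪_F)`), and ENTRYWISE `g = ι_d(z)·diag(1, ϖ^j)·k`: `g₀ᵢ = u Uᵢ − v(dσd)(ϖ^j Wᵢ)`, `g₁ᵢ = v Uᵢ + (u + v(d+σd))(ϖ^j Wᵢ)`.
[cite: Flicker1998UnitaryFL, REMARK p. 84; Prop. 6 p. 83] -/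
theorem exists_coords_eq_iota_diag_pow [IsDomain R] [IsDiscreteValuationRing R] (hσR : ∀ r, σR (σR r) = r) {dR : R} (hdR : IsUnit (σR dR - dR))
    {ϖR : R} (hϖR : Irreducible ϖR) (hσϖR : σR ϖR = ϖR)
    (g : Matrix (Fin 2) (Fin 2) K) (hg : ∀ a b, σ (g a b) = g a b) (hgv : ∀ a b, Valued.v (g a b) ≤ 1)
    (hdet : g 0 0 * g 1 1 - g 0 1 * g 1 0 ≠ 0) :
    ∃ (u v : K) (j : ℕ) (U₀ U₁ W₀ W₁ : K), σ u = u ∧ σ v = v ∧ Valued.v u ≤ 1 ∧ Valued.v v ≤ 1 ∧ u + v * i dR ≠ 0 ∧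
      σ U₀ = U₀ ∧ σ U₁ = U₁ ∧ σ W₀ = W₀ ∧ σ W₁ = W₁ ∧
      Valued.v U₀ ≤ 1 ∧ Valued.v U₁ ≤ 1 ∧ Valued.v W₀ ≤ 1 ∧ Valued.v W₁ ≤ 1 ∧ Valued.v (U₀ * W₁ - U₁ * W₀) = 1 ∧
      g 0 0 = u * U₀ - v * (i dR * σ (i dR)) * (i ϖR ^ j * W₀) ∧ g 1 0 = v * U₀ + (u + v * (i dR + σ (i dR))) * (i ϖR ^ j * W₀) ∧
      g 0 1 = u * U₁ - v * (i dR * σ (i dR)) * (i ϖR ^ j * W₁) ∧ g 1 1 = v * U₁ + (u + v * (i dR + σ (i dR))) * (i ϖR ^ j * W₁) := by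
  -- lift `g` to `R`
  obtain ⟨G00, hG00, e00⟩ := exists_lift_fixed σ i hi hiv σR hσi (hgv 0 0) (hg 0 0)
  obtain ⟨G01, hG01, e01⟩ := exists_lift_fixed σ i hi hiv σR hσi (hgv 0 1) (hg 0 1)
  obtain ⟨G10, hG10, e10⟩ := exists_lift_fixed σ i hi hiv σR hσi (hgv 1 0) (hg 1 0)
  obtain ⟨G11, hG11, e11⟩ := exists_lift_fixed σ i hi hiv σR hσi (hgv 1 1) (hg 1 1)
  let G : Matrix (Fin 2) (Fin 2) R := !![G00, G01; G10, G11]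
  have hG : ∀ a b, σR (G a b) = G a b := by
    intro a b; fin_cases a <;> fin_cases b <;> simp [G, hG00, hG01, hG10, hG11]
  have hGdet : G 0 0 * G 1 1 - G 0 1 * G 1 0 ≠ 0 := by
    intro h0
    apply hdet
    have := congrArg i h0
    rw [map_sub, map_mul, map_mul, map_zero] at this
    simpa [G, e00, e01, e10, e11] using this
  obtain ⟨u, v, j, U₀, U₁, W₀, W₁, hu, hv, hz, hU₀, hU₁, hW₀, hW₁, hunit, f00, f10, f01, f11⟩ :=
    Literature.NumberTheory.LocalFields.UnramifiedQuadraticNorm.exists_coords_eq_iota_diag_pow σR hσR hdR hϖR hσϖR G hG hGdet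
  have fix : ∀ {r : R}, σR r = r → σ (i r) = i r := fun {r} hr => by rw [← hσi, hr]
  refine ⟨i u, i v, j, i U₀, i U₁, i W₀, i W₁, fix hu, fix hv, v_le_one i hiv u, v_le_one i hiv v, ?_,
    fix hU₀, fix hU₁, fix hW₀, fix hW₁, v_le_one i hiv U₀, v_le_one i hiv U₁, v_le_one i hiv W₀, v_le_one i hiv W₁, ?_, ?_, ?_, ?_, ?_⟩
  · intro h0
    apply hz
    apply hi
    rw [map_add, map_mul, map_zero]; exact h0
  · rw [← map_mul, ← map_mul, ← map_sub]; exact v_eq_one_of_isUnit i hiv hunit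
  · have := congrArg i f00
    rw [← e00]; simpa [G, map_sub, map_mul, map_add, map_pow, hσi] using this
  · have := congrArg i f10
    rw [← e10]; simpa [G, map_sub, map_mul, map_add, map_pow, hσi] using this
  · have := congrArg i f01
    rw [← e01]; simpa [G, map_sub, map_mul, map_add, map_pow, hσi] using this
  · have := congrArg i f11
    rw [← e11]; simpa [G, map_sub, map_mul, map_add, map_pow, hσi] using this

end TorusBridge

end Literature.NumberTheory.Automorphic.UnitaryGroup
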